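import Summits.QuantumFields.BalabanUV.Beta.GAN24.LayerTransportCount
import Summits.QuantumFields.BalabanUV.Beta.GAN24.LayerFrozenCount

/-!
# `BalabanUV.Beta.GAN24.LayerTransportLedger` — binder row G-an2-4 / (CONV-C), W-slot CT-W, route «WC-TL» ∕ «QR-LL», row **(LT-Δ) «LAYER TRANSPORT»**, part (LT-3) END OF THE PURE CELL:
# THE WHOLE LEDGER IN ONE STATEMENT — remainder (`LayerTransportCount`, one gradient constant, `L^{d−4}`) PLUS the frozen charged term (`LayerFrozenCount`, per-label moments,
# free second-difference scale `S₂`, `S₂·L^{2d}`) for legs GIVEN BY ENVELOPES; at `d = 3` in the Hölder-3∕2 currency of record: `K_E·L⁻¹ + K_G·(√L)⁻¹`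

NOT IN PRINT; OUR BOOKKEEPING ([folklore] `LayerTransportCount.abs_cubic_push₃_sub_frozen_layer_le` (p320734 ✓) + `LayerFrozenCount.abs_cubic_frozen_le` composed through ONE
displayed hypothesis — the per-slot field–field charge of the letter family is a SUM OVER LABELS of per-label profiles — and three finite-sum ∕ `tsum` exchanges; G-an2-4
formalisation swarm, leaf prover `b2b-balaban-gan24-formalise-leaf-01`, gen 64).  HONEST FRAMING (cell contract, verbatim): «discharging `BetaPertH` makes Bałaban's UV stability
UNCONDITIONAL — a real constructive-QFT result; it is NOT the continuum limit and NOT the Clay problem.»  HONEST DEPENDENCY (verbatim): «continuum YM on T⁴ ⇐ BetaPertH ∧ nine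
spine estimates (0/9 proved); BetaPertH ⇐ (D1) ∧ (D4) ∧ CAP+tail; G-an2-4 gates asym, D1 and NE2/3/4.»

## What (generic `d`, relative blocking `L ≥ 1`, GENERIC legs ∕ letters — no object of an2's typed system occurs)
§1 `summable_legs3_mul_profile`, `frozen_eq_sum_labels` — the FROZEN charge term of `LayerPushFrozen.abs_push₃_sub_frozen_le_weighted` rewritten label by label under
   `hQ : ∀ k κ₁ κ₂ u, Σ'_x Σ'_z S k u x z κ₁ κ₂ = Σ_{y∈T} Z k κ₁ κ₂ y u` (the charge audit's decomposition, a HYPOTHESIS):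
   `FROZEN = Σ_k Σ_{κ₂} Σ_{κ₁} Σ_{y∈T} Σ'_u (w ν U k u·l α x′ κ₁ u·r β z′ κ₂ u)·Z k κ₁ κ₂ y u`.
§2 **`abs_cubic_push₃_layer_ledger_le`** (generic `d`, free `S₂ ≥ (L^{d+4})⁻¹`): three legs with (N1)∕(N1′) envelopes `A·(L^{d+2})⁻¹`, `A′·(L^{d+3})⁻¹` and unit second
   differences `A″·S₂` (all three legs — the literal's legs are one and the same chain), letter family with the weighted slot profile `Cs·ω u·e^{−m(‖x−u‖₁+‖z−u‖₁)}` under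
   leaf-03's face weight of the block of label `y` (rate `δ`), per-slot charges = Σ over labels `y′ ∈ T` of profiles `|Z … y′ e| ≤ B·e^{−δZ‖e−y′‖₁}` with (M0_{y′}), (Π_{y′}),
   `4κ < δZ`, labels within `ρ` of `Y`, `|T| ≤ CT·L^{d+1}` ⇒
   `|L^{3(d+1)}·push₃ l r w S ν U x′ z′ (inl α)(inl β)| ≤ K_E·L^d·(L^4)⁻¹·e^{−(κ∕4)(‖x′−U‖₁+‖z′−U‖₁)}·e^{−η‖y−U‖₁} + (d+1)³·K_G·CT·(S₂·L^{2d})·e^{−(κ∕4)(…)}·e^{−(κ∕2)‖Y−U‖₁}`,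
   `η = min (κ∕2) (δ∕2)`, `K_E`, `K_G` the two files' constants, FREE OF `L` and `S₂`.
§3 **`abs_cubic_push₃_layer_ledger_three_half`**: `d = 3`, `S₂ = (L^6·√L)⁻¹` ⇒ `K_E·L⁻¹·(…) + 4³·K_G·CT·(√L)⁻¹·(…)` — both net exponents NEGATIVE: the (LT-3) pure cell of QR-LL
   closes (DUH) for legs given by envelopes, modulo ONLY the letter-side binders (`hS`, `hω`, `hQ`, `hZ`, `hM0`, `hP1`, `hT`, `hTcard`).
WHAT IT IS NOT: the literal's legs are DRESSED (`respStep + dz λ`; seams, K-LL-4 — journal R-leaf01-g63-5, R-gan24p1-g26-2; the gauge cells are `LayerPushGaugeLeft` ∕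
`LayerPushGaugeTableCell`, marginal by absolute counting); on UNDRESSED decimated columns the leg binders are leaf-12's (N1)(N1′) and leaf-02 g54's (N1″)_{1∕2} in `ℓ¹` currency
(their junction certificates R-leaf02-g54-2∕-3: zero adapter); the letter-side binders are the CHARGE AUDIT's (E15) and (LAY)'s.  [folklore]; 0 cited facts, 0 `def`, 0 `def … : Prop`,
0 sorry.  NOTHING of (Q-R)∕(LT)∕(Q-L)∕(C)∕«T2Shape»∕«T2Drift»∕(hW, hWall) discharged; NEVER «G-an2-4 closed» as (CONV-C); NOT D1, NOT `BetaPertH`, NOT continuum, NOT Clay.  2026-08-22.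
-/

noncomputable section

open Finset
open scoped BigOperators
open Literature.MathematicalPhysics.QuantumFieldTheory
open Literature.MathematicalPhysics.QuantumFieldTheory.Balaban1983to89
open Literature.MathematicalPhysics.QuantumFieldTheory.Balaban1983to89.Beta
open B12Sec2to5 (l1 l1_nonneg)
open B6BondElimination (unitVec)
open ExpKernelCalculus (MKer Site Zl Zl_nonneg Zl_pos summable_exp_shift')
open OneStepResolventKernel (Fib)
open LatticeForm (quo)
open AffineAveraging (box toSite)
open Summit.QuantumFields.BalabanUV.Beta.GAN24.Push3 (push₃)
open Summit.QuantumFields.BalabanUV.Beta.GAN24.LayerTransportCount (abs_cubic_push₃_sub_frozen_layer_le)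
open Summit.QuantumFields.BalabanUV.Beta.GAN24.LayerFrozenCount (abs_cubic_frozen_le inv_pow_le_inv_pow_sqrt)

namespace Summit.QuantumFields.BalabanUV.Beta.GAN24.LayerTransportLedger

variable {d : ℕ}

/-! ## §1 The frozen charge term, label by label -/

section Frozen

variable {l r w : Fin (d + 1) → (Fin (d + 1) → ℤ) → Fin (d + 1) → (Fin (d + 1) → ℤ) → ℝ}
  {S : Fin (d + 1) → (Fin (d + 1) → ℤ) → MKer (d + 1) (Fib d)}
  {Z : Fin (d + 1) → Fin (d + 1) → Fin (d + 1) → (Fin (d + 1) → ℤ) → (Fin (d + 1) → ℤ) → ℝ} {T : Finset (Fin (d + 1) → ℤ)}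
  {L : ℕ} {A κ B δZ : ℝ}

/-- [folklore] The three legs at one slot against one label's charge profile are absolutely summable over the slot (legs bounded by their envelopes' constants, profile
localised at the label). -/
theorem summable_legs3_mul_profile (hL : 1 ≤ L) (hκ : 0 ≤ κ) (hA : 0 ≤ A) (hδZ : 0 < δZ)
    (hl : ∀ α x' k x, |l α x' k x| ≤ A * (((L : ℝ)) ^ (d + 2))⁻¹ * Real.exp (-κ * l1 (quo L x - x')))
    (hr : ∀ β z' k z, |r β z' k z| ≤ A * (((L : ℝ)) ^ (d + 2))⁻¹ * Real.exp (-κ * l1 (quo L z - z')))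
    (hw : ∀ ν U k u, |w ν U k u| ≤ A * (((L : ℝ)) ^ (d + 2))⁻¹ * Real.exp (-κ * l1 (quo L u - U)))
    (hZ : ∀ k κ₁ κ₂, ∀ y ∈ T, ∀ e, |Z k κ₁ κ₂ y e| ≤ B * Real.exp (-δZ * l1 (e - y)))
    (ν : Fin (d + 1)) (U x' z' : Fin (d + 1) → ℤ) (α β k κ₁ κ₂ : Fin (d + 1)) (y : Fin (d + 1) → ℤ) (hy : y ∈ T) :
    Summable fun u : Fin (d + 1) → ℤ => (w ν U k u * l α x' κ₁ u * r β z' κ₂ u) * Z k κ₁ κ₂ y u := by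
  have hL0 : (0 : ℝ) < (L : ℝ) := by exact_mod_cast hL
  set P : ℝ := A * (((L : ℝ)) ^ (d + 2))⁻¹ with hP
  have hP0 : 0 ≤ P := by positivity
  have hB : 0 ≤ B := by
    have h0 := hZ k κ₁ κ₂ y hy y
    rw [sub_self, show l1 (0 : Fin (d + 1) → ℤ) = 0 by simp [l1], mul_zero, Real.exp_zero, mul_one] at h0
    exact (abs_nonneg _).trans h0
  have he1 : ∀ (v : Fin (d + 1) → ℤ), Real.exp (-κ * l1 v) ≤ 1 := fun v => Real.exp_le_one_iff.2 (by nlinarith [l1_nonneg v])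
  have hwb : ∀ u, |w ν U k u| ≤ P := fun u => (hw ν U k u).trans (mul_le_of_le_one_right hP0 (he1 _))
  have hlb : ∀ u, |l α x' κ₁ u| ≤ P := fun u => (hl α x' κ₁ u).trans (mul_le_of_le_one_right hP0 (he1 _))
  have hrb : ∀ u, |r β z' κ₂ u| ≤ P := fun u => (hr β z' κ₂ u).trans (mul_le_of_le_one_right hP0 (he1 _))
  refine Summable.of_norm_bounded ((summable_exp_shift' hδZ y).mul_left (P * P * P * B)) fun u => ?_
  rw [Real.norm_eq_abs, abs_mul, abs_mul, abs_mul]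
  calc |w ν U k u| * |l α x' κ₁ u| * |r β z' κ₂ u| * |Z k κ₁ κ₂ y u| ≤ P * P * P * (B * Real.exp (-δZ * l1 (u - y))) :=
        mul_le_mul (mul_le_mul (mul_le_mul (hwb u) (hlb u) (abs_nonneg _) hP0) (hrb u) (abs_nonneg _) (by positivity))
          (hZ k κ₁ κ₂ y hy u) (abs_nonneg _) (by positivity)
    _ = _ := by ring

/-- NOT IN PRINT; OUR BOOKKEEPING.  **THE FROZEN CHARGE TERM LABEL BY LABEL**: under the label decomposition of the per-slot field–field charges
`hQ : Σ'_x Σ'_z S k u x z κ₁ κ₂ = Σ_{y∈T} Z k κ₁ κ₂ y u`, the frozen term of `LayerPushFrozen.abs_push₃_sub_frozen_le_weighted` is the finite triple-index ∕ label sum of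
one-label frozen pairings of the leg product: `FROZEN = Σ_k Σ_{κ₂} Σ_{κ₁} Σ_{y∈T} Σ'_u (w·l·r)(u)·Z k κ₁ κ₂ y u`. -/
theorem frozen_eq_sum_labels (hL : 1 ≤ L) (hκ : 0 ≤ κ) (hA : 0 ≤ A) (hδZ : 0 < δZ)
    (hl : ∀ α x' k x, |l α x' k x| ≤ A * (((L : ℝ)) ^ (d + 2))⁻¹ * Real.exp (-κ * l1 (quo L x - x')))
    (hr : ∀ β z' k z, |r β z' k z| ≤ A * (((L : ℝ)) ^ (d + 2))⁻¹ * Real.exp (-κ * l1 (quo L z - z')))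
    (hw : ∀ ν U k u, |w ν U k u| ≤ A * (((L : ℝ)) ^ (d + 2))⁻¹ * Real.exp (-κ * l1 (quo L u - U)))
    (hZ : ∀ k κ₁ κ₂, ∀ y ∈ T, ∀ e, |Z k κ₁ κ₂ y e| ≤ B * Real.exp (-δZ * l1 (e - y)))
    (hQ : ∀ k κ₁ κ₂ u, ∑' x, ∑' z, S k u x z (Sum.inl κ₁) (Sum.inl κ₂) = ∑ y ∈ T, Z k κ₁ κ₂ y u)
    (ν : Fin (d + 1)) (U x' z' : Fin (d + 1) → ℤ) (α β : Fin (d + 1)) :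
    (∑ k : Fin (d + 1), ∑' u : Fin (d + 1) → ℤ, w ν U k u *
        ∑ κ₂ : Fin (d + 1), ∑ κ₁ : Fin (d + 1), l α x' κ₁ u * r β z' κ₂ u * ∑' x, ∑' z, S k u x z (Sum.inl κ₁) (Sum.inl κ₂))
      = ∑ k : Fin (d + 1), ∑ κ₂ : Fin (d + 1), ∑ κ₁ : Fin (d + 1), ∑ y ∈ T,
          ∑' u : Fin (d + 1) → ℤ, (w ν U k u * l α x' κ₁ u * r β z' κ₂ u) * Z k κ₁ κ₂ y u := by
  refine Finset.sum_congr rfl fun k _ => ?_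
  have hs : ∀ κ₂ κ₁, ∀ y ∈ T, Summable fun u : Fin (d + 1) → ℤ => (w ν U k u * l α x' κ₁ u * r β z' κ₂ u) * Z k κ₁ κ₂ y u :=
    fun κ₂ κ₁ y hy => summable_legs3_mul_profile hL hκ hA hδZ hl hr hw hZ ν U x' z' α β k κ₁ κ₂ y hy
  -- pointwise in `u`: distribute the table leg and the label sum
  have ept : ∀ u, w ν U k u * ∑ κ₂ : Fin (d + 1), ∑ κ₁ : Fin (d + 1), l α x' κ₁ u * r β z' κ₂ u * ∑' x, ∑' z, S k u x z (Sum.inl κ₁) (Sum.inl κ₂)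
      = ∑ κ₂ : Fin (d + 1), ∑ κ₁ : Fin (d + 1), ∑ y ∈ T, (w ν U k u * l α x' κ₁ u * r β z' κ₂ u) * Z k κ₁ κ₂ y u := by
    intro u
    rw [Finset.mul_sum]
    refine Finset.sum_congr rfl fun κ₂ _ => ?_
    rw [Finset.mul_sum]
    refine Finset.sum_congr rfl fun κ₁ _ => ?_
    rw [hQ k κ₁ κ₂ u, Finset.mul_sum, Finset.mul_sum]
    exact Finset.sum_congr rfl fun y _ => by ring
  rw [tsum_congr ept]
  rw [Summable.tsum_finsetSum (fun κ₂ _ => summable_sum fun κ₁ _ => summable_sum fun y hy => hs κ₂ κ₁ y hy)]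
  refine Finset.sum_congr rfl fun κ₂ _ => ?_
  rw [Summable.tsum_finsetSum (fun κ₁ _ => summable_sum fun y hy => hs κ₂ κ₁ y hy)]
  refine Finset.sum_congr rfl fun κ₁ _ => ?_
  exact Summable.tsum_finsetSum fun y hy => hs κ₂ κ₁ y hy

end Frozen

/-! ## §2 The END of the pure cell: remainder plus frozen term -/

section End

variable {l r w : Fin (d + 1) → (Fin (d + 1) → ℤ) → Fin (d + 1) → (Fin (d + 1) → ℤ) → ℝ}
  {S : Fin (d + 1) → (Fin (d + 1) → ℤ) → MKer (d + 1) (Fib d)} {ω : (Fin (d + 1) → ℤ) → ℝ}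
  {Z : Fin (d + 1) → Fin (d + 1) → Fin (d + 1) → (Fin (d + 1) → ℤ) → (Fin (d + 1) → ℤ) → ℝ} {T : Finset (Fin (d + 1) → ℤ)}
  {L : ℕ} {A A' A'' S₂ Cs κ m δ B δZ ρ CT : ℝ} {Y : Fin (d + 1) → ℤ}

/-- NOT IN PRINT; OUR BOOKKEEPING (`LayerTransportCount.abs_cubic_push₃_sub_frozen_layer_le` ⨾ §1 `frozen_eq_sum_labels` ⨾ `LayerFrozenCount.abs_cubic_frozen_le` label block by
label block ⨾ the triangle inequality).  **(LT-3) THE PURE CELL's LEDGER IN ONE STATEMENT, GENERIC `d`, FREE SECOND-DIFFERENCE SCALE `S₂ ≥ (L^{d+4})⁻¹`**: at relative blocking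
`L ≥ 1`, three legs with (N1)-type envelopes `A·(L^{d+2})⁻¹·e^{−κ‖quo L · − c‖₁}`, (N1′)-type unit-gradient envelopes `A′·(L^{d+3})⁻¹·(…)` and unit second differences
`A″·S₂·(…)`; a field-valued letter family with the weighted slot profile `Cs·ω u·e^{−m(‖x−u‖₁+‖z−u‖₁)}` (`κ < m`) whose weight is dominated by leaf-03's face weight of the block of
label `y` (rate `δ`); per-slot field–field charges decomposed over labels `y′ ∈ T` into profiles `Z` localised at `y′` (`B`, rate `δZ > 4κ`) with ZERO TOTAL (M0_{y′}) and ZERO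
SLOT-DIPOLE (Π_{y′}) each, labels within `ρ` coarse labels of `Y`, `|T| ≤ CT·L^{d+1}`.  Then the CUBIC-WEIGHTED push obeys
`|L^{3(d+1)}·push₃ l r w S ν U x′ z′ (inl α)(inl β)| ≤ K_E·(L^d·(L^4)⁻¹)·e^{−(κ∕4)(‖x′−U‖₁+‖z′−U‖₁)}·e^{−η‖y−U‖₁} + (d+1)³·(K_G·CT)·(S₂·L^{2d})·e^{−(κ∕4)(…)}·e^{−(κ∕2)‖Y−U‖₁}`,
`η = min (κ∕2) (δ∕2)` — the REMAINDER (one gradient constant, net `d − 4`) plus the FROZEN CHARGED TERM (second order in the legs, net `S₂·L^{2d}`); `K_E`, `K_G` free of `L`, `S₂`. -/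
theorem abs_cubic_push₃_layer_ledger_le (hL : 1 ≤ L) (hκ : 0 < κ) (hm : κ < m) (hδ : 0 < δ) (hA : 0 ≤ A) (hA' : 0 ≤ A') (hA'' : 0 ≤ A'') (hCs : 0 ≤ Cs)
    (hB : 0 ≤ B) (hκδZ : 4 * κ < δZ) (hS₂ : (((L : ℝ)) ^ (d + 4))⁻¹ ≤ S₂)
    (hl : ∀ α x' k x, |l α x' k x| ≤ A * (((L : ℝ)) ^ (d + 2))⁻¹ * Real.exp (-κ * l1 (quo L x - x')))
    (hl' : ∀ α x' k x i, |l α x' k (x + Pi.single i 1) - l α x' k x| ≤ A' * (((L : ℝ)) ^ (d + 3))⁻¹ * Real.exp (-κ * l1 (quo L x - x')))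
    (hl'' : ∀ α x' k x i j, |(l α x' k (x + Pi.single i 1 + Pi.single j 1) - l α x' k (x + Pi.single j 1)) - (l α x' k (x + Pi.single i 1) - l α x' k x)|
      ≤ A'' * S₂ * Real.exp (-κ * l1 (quo L x - x')))
    (hr : ∀ β z' k z, |r β z' k z| ≤ A * (((L : ℝ)) ^ (d + 2))⁻¹ * Real.exp (-κ * l1 (quo L z - z')))
    (hr' : ∀ β z' k z i, |r β z' k (z + Pi.single i 1) - r β z' k z| ≤ A' * (((L : ℝ)) ^ (d + 3))⁻¹ * Real.exp (-κ * l1 (quo L z - z')))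
    (hr'' : ∀ β z' k z i j, |(r β z' k (z + Pi.single i 1 + Pi.single j 1) - r β z' k (z + Pi.single j 1)) - (r β z' k (z + Pi.single i 1) - r β z' k z)|
      ≤ A'' * S₂ * Real.exp (-κ * l1 (quo L z - z')))
    (hw : ∀ ν U k u, |w ν U k u| ≤ A * (((L : ℝ)) ^ (d + 2))⁻¹ * Real.exp (-κ * l1 (quo L u - U)))
    (hw' : ∀ ν U k u i, |w ν U k (u + Pi.single i 1) - w ν U k u| ≤ A' * (((L : ℝ)) ^ (d + 3))⁻¹ * Real.exp (-κ * l1 (quo L u - U)))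
    (hw'' : ∀ ν U k u i j, |(w ν U k (u + Pi.single i 1 + Pi.single j 1) - w ν U k (u + Pi.single j 1)) - (w ν U k (u + Pi.single i 1) - w ν U k u)|
      ≤ A'' * S₂ * Real.exp (-κ * l1 (quo L u - U)))
    (hS : ∀ k u x z a b, |S k u x z a b| ≤ Cs * ω u * Real.exp (-m * (l1 (x - u) + l1 (z - u))))
    (y : Fin (d + 1) → ℤ)
    (hω : ∀ u, 0 ≤ ω u ∧ ω u ≤ ∑ μ : Fin (d + 1),
      (∑ v ∈ ((box (d + 1) L).filter (fun v => v μ = L - 1)).image (fun v => (L : ℤ) • y + toSite v), Real.exp (-δ * l1 (v - u))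
        + ∑ v ∈ ((box (d + 1) L).filter (fun v => v μ = 0)).image (fun v => (L : ℤ) • y + toSite v - unitVec μ),
            Real.exp (-δ * l1 (v - u))))
    (hQ : ∀ k κ₁ κ₂ u, ∑' x, ∑' z, S k u x z (Sum.inl κ₁) (Sum.inl κ₂) = ∑ y' ∈ T, Z k κ₁ κ₂ y' u)
    (hZ : ∀ k κ₁ κ₂, ∀ y' ∈ T, ∀ e, |Z k κ₁ κ₂ y' e| ≤ B * Real.exp (-δZ * l1 (e - y')))
    (hM0 : ∀ k κ₁ κ₂, ∀ y' ∈ T, ∑' e, Z k κ₁ κ₂ y' e = 0)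
    (hP1 : ∀ k κ₁ κ₂, ∀ y' ∈ T, ∀ i : Fin (d + 1), ∑' e, (((e - y') i : ℤ) : ℝ) * Z k κ₁ κ₂ y' e = 0)
    (hT : ∀ y' ∈ T, l1 (quo L y' - Y) ≤ ρ) (hTcard : (T.card : ℝ) ≤ CT * (L : ℝ) ^ (d + 1))
    (ν : Fin (d + 1)) (U x' z' : Fin (d + 1) → ℤ) (α β : Fin (d + 1)) :
    |(L : ℝ) ^ (3 * (d + 1)) * push₃ l r w S ν U x' z' (Sum.inl α) (Sum.inl β)|
      ≤ ((((d : ℝ) + 1) ^ 3 * A ^ 2 * A' * Cs * (2 / (m - κ) * Zl (d + 1) ((m - κ) / 2)) * (Zl (d + 1) (m - κ) + Zl (d + 1) m))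
            * ((2 * ((d : ℝ) + 1)) ^ 2 * Zl (d + 1) (δ / 2) * Real.exp (min (κ / 2) (δ / 2))))
          * ((L : ℝ) ^ d * ((L : ℝ) ^ 4)⁻¹)
          * Real.exp (-(κ / 4) * (l1 (x' - U) + l1 (z' - U))) * Real.exp (-(min (κ / 2) (δ / 2)) * l1 (y - U))
        + ((d : ℝ) + 1) ^ 3 *
          (((((A'' * A * A + 2 * A' * A' * A + A * A'' * A) * Real.exp (2 * κ) + 2 * ((A' * A + A * A') * Real.exp κ) * A' + A * A * A'')
              * Real.exp (2 * (2 * κ))) * B * (8 / (δZ - 2 * (2 * κ)) ^ 2 * Zl (d + 1) ((δZ - 2 * (2 * κ)) / 4)) * Real.exp ((κ / 2) * ρ) * CT)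
            * (S₂ * (L : ℝ) ^ (2 * d))
            * Real.exp (-(κ / 4) * (l1 (x' - U) + l1 (z' - U))) * Real.exp (-(κ / 2) * l1 (Y - U))) := by
  have hL0 : (0 : ℝ) < (L : ℝ) := by exact_mod_cast hL
  have hκ0 := hκ.le
  have hδZ : 0 < δZ := by linarith
  -- (1) the remainder
  have hE := abs_cubic_push₃_sub_frozen_layer_le hL hκ hm hδ hA hA' hCs hl hl' hr hr' hw hS y hω ν U x' z' α β
  -- (2) the frozen term label by label
  have hfrozen := frozen_eq_sum_labels (S := S) hL hκ0 hA hδZ hl hr hw hZ hQ ν U x' z' α β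
  -- per index triple: `LayerFrozenCount.abs_cubic_frozen_le` with `a := w ν U k`, `b := l α x' κ₁`, `c := r β z' κ₂`
  set KG : ℝ := ((((A'' * A * A + 2 * A' * A' * A + A * A'' * A) * Real.exp (2 * κ) + 2 * ((A' * A + A * A') * Real.exp κ) * A' + A * A * A'')
      * Real.exp (2 * (2 * κ))) * B * (8 / (δZ - 2 * (2 * κ)) ^ 2 * Zl (d + 1) ((δZ - 2 * (2 * κ)) / 4)) * Real.exp ((κ / 2) * ρ) * CT)
    * (S₂ * (L : ℝ) ^ (2 * d))
    * Real.exp (-(κ / 4) * (l1 (x' - U) + l1 (z' - U))) * Real.exp (-(κ / 2) * l1 (Y - U)) with hKG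
  have hblock : ∀ k κ₁ κ₂, |(L : ℝ) ^ (3 * (d + 1)) * ∑ y' ∈ T, ∑' u : Fin (d + 1) → ℤ,
      (w ν U k u * l α x' κ₁ u * r β z' κ₂ u) * Z k κ₁ κ₂ y' u| ≤ KG := by
    intro k κ₁ κ₂
    have h := abs_cubic_frozen_le (a := w ν U k) (b := l α x' κ₁) (c := r β z' κ₂) (Zy := Z k κ₁ κ₂) (T := T)
      (cU := U) (cx := x') (cz := z') (Y := Y) hL hκ hκδZ hA hA' hA'' hB (CT := CT) hS₂
      (fun u => hw ν U k u) (fun u i => hw' ν U k u i) (fun u i j => hw'' ν U k u i j)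
      (fun u => hl α x' κ₁ u) (fun u i => hl' α x' κ₁ u i) (fun u i j => hl'' α x' κ₁ u i j)
      (fun u => hr β z' κ₂ u) (fun u i => hr' β z' κ₂ u i) (fun u i j => hr'' β z' κ₂ u i j)
      (hZ k κ₁ κ₂) (hM0 k κ₁ κ₂) (hP1 k κ₁ κ₂) hT hTcard
    rw [hKG]
    exact h
  have hKG0 : 0 ≤ KG := le_trans (abs_nonneg _) (hblock 0 0 0)
  have hF : |(L : ℝ) ^ (3 * (d + 1)) * ∑ k : Fin (d + 1), ∑' u : Fin (d + 1) → ℤ, w ν U k u *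
      ∑ κ₂ : Fin (d + 1), ∑ κ₁ : Fin (d + 1), l α x' κ₁ u * r β z' κ₂ u * ∑' x, ∑' z, S k u x z (Sum.inl κ₁) (Sum.inl κ₂)|
      ≤ ((d : ℝ) + 1) ^ 3 * KG := by
    rw [hfrozen, Finset.mul_sum]
    calc _ ≤ ∑ k : Fin (d + 1), |(L : ℝ) ^ (3 * (d + 1)) * ∑ κ₂ : Fin (d + 1), ∑ κ₁ : Fin (d + 1), ∑ y' ∈ T,
            ∑' u : Fin (d + 1) → ℤ, (w ν U k u * l α x' κ₁ u * r β z' κ₂ u) * Z k κ₁ κ₂ y' u| := Finset.abs_sum_le_sum_abs _ _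
      _ ≤ ∑ _k : Fin (d + 1), ((d : ℝ) + 1) ^ 2 * KG := Finset.sum_le_sum fun k _ => by
          rw [Finset.mul_sum]
          calc _ ≤ ∑ κ₂ : Fin (d + 1), |(L : ℝ) ^ (3 * (d + 1)) * ∑ κ₁ : Fin (d + 1), ∑ y' ∈ T,
                  ∑' u : Fin (d + 1) → ℤ, (w ν U k u * l α x' κ₁ u * r β z' κ₂ u) * Z k κ₁ κ₂ y' u| := Finset.abs_sum_le_sum_abs _ _
            _ ≤ ∑ _κ₂ : Fin (d + 1), ((d : ℝ) + 1) * KG := Finset.sum_le_sum fun κ₂ _ => by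
                rw [Finset.mul_sum]
                calc _ ≤ ∑ κ₁ : Fin (d + 1), |(L : ℝ) ^ (3 * (d + 1)) * ∑ y' ∈ T,
                        ∑' u : Fin (d + 1) → ℤ, (w ν U k u * l α x' κ₁ u * r β z' κ₂ u) * Z k κ₁ κ₂ y' u| := Finset.abs_sum_le_sum_abs _ _
                  _ ≤ ∑ _κ₁ : Fin (d + 1), KG := Finset.sum_le_sum fun κ₁ _ => hblock k κ₁ κ₂
                  _ = _ := by rw [Finset.sum_const, Finset.card_univ, Fintype.card_fin, nsmul_eq_mul]; push_cast; ring
            _ = _ := by rw [Finset.sum_const, Finset.card_univ, Fintype.card_fin, nsmul_eq_mul]; push_cast; ring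
      _ = _ := by rw [Finset.sum_const, Finset.card_univ, Fintype.card_fin, nsmul_eq_mul]; push_cast; ring
  -- (3) assemble
  have esplit : (L : ℝ) ^ (3 * (d + 1)) * push₃ l r w S ν U x' z' (Sum.inl α) (Sum.inl β)
      = (L : ℝ) ^ (3 * (d + 1)) * (push₃ l r w S ν U x' z' (Sum.inl α) (Sum.inl β)
          - ∑ k : Fin (d + 1), ∑' u : Fin (d + 1) → ℤ, w ν U k u *
              ∑ κ₂ : Fin (d + 1), ∑ κ₁ : Fin (d + 1), l α x' κ₁ u * r β z' κ₂ u * ∑' x, ∑' z, S k u x z (Sum.inl κ₁) (Sum.inl κ₂))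
        + (L : ℝ) ^ (3 * (d + 1)) * ∑ k : Fin (d + 1), ∑' u : Fin (d + 1) → ℤ, w ν U k u *
              ∑ κ₂ : Fin (d + 1), ∑ κ₁ : Fin (d + 1), l α x' κ₁ u * r β z' κ₂ u * ∑' x, ∑' z, S k u x z (Sum.inl κ₁) (Sum.inl κ₂) := by ring
  rw [esplit]
  refine (abs_add_le _ _).trans (add_le_add hE ?_)
  rw [hKG] at hF
  exact hF

/-- NOT IN PRINT; OUR BOOKKEEPING.  **(LT-3) THE PURE CELL AT `d = 3` IN THE HÖLDER-3∕2 CURRENCY OF RECORD** (`S₂ = (L^6·√L)⁻¹`, leaf-02 g54's (N1″)_{1∕2}): the cubic-weighted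
push nets `K_E·L⁻¹·(…)` (remainder) `+ 4³·K_G·CT·(√L)⁻¹·(…)` (frozen charged term) — BOTH NET EXPONENTS NEGATIVE: the (DUH) geometric sum of the OWNER's `WardRemainderRows`
closes on this cell with ratio `Lc^{−1∕2}`, for legs GIVEN BY ENVELOPES and modulo only the letter-side binders. -/
theorem abs_cubic_push₃_layer_ledger_three_half {l r w : Fin (3 + 1) → (Fin (3 + 1) → ℤ) → Fin (3 + 1) → (Fin (3 + 1) → ℤ) → ℝ}
    {S : Fin (3 + 1) → (Fin (3 + 1) → ℤ) → MKer (3 + 1) (Fib 3)} {ω : (Fin (3 + 1) → ℤ) → ℝ}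
    {Z : Fin (3 + 1) → Fin (3 + 1) → Fin (3 + 1) → (Fin (3 + 1) → ℤ) → (Fin (3 + 1) → ℤ) → ℝ} {T : Finset (Fin (3 + 1) → ℤ)}
    {L : ℕ} {A A' A'' Cs κ m δ B δZ ρ CT : ℝ} {Y : Fin (3 + 1) → ℤ}
    (hL : 1 ≤ L) (hκ : 0 < κ) (hm : κ < m) (hδ : 0 < δ) (hA : 0 ≤ A) (hA' : 0 ≤ A') (hA'' : 0 ≤ A'') (hCs : 0 ≤ Cs)
    (hB : 0 ≤ B) (hκδZ : 4 * κ < δZ)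
    (hl : ∀ α x' k x, |l α x' k x| ≤ A * (((L : ℝ)) ^ (3 + 2))⁻¹ * Real.exp (-κ * l1 (quo L x - x')))
    (hl' : ∀ α x' k x i, |l α x' k (x + Pi.single i 1) - l α x' k x| ≤ A' * (((L : ℝ)) ^ (3 + 3))⁻¹ * Real.exp (-κ * l1 (quo L x - x')))
    (hl'' : ∀ α x' k x i j, |(l α x' k (x + Pi.single i 1 + Pi.single j 1) - l α x' k (x + Pi.single j 1)) - (l α x' k (x + Pi.single i 1) - l α x' k x)|
      ≤ A'' * (((L : ℝ)) ^ (3 + 3) * Real.sqrt (L : ℝ))⁻¹ * Real.exp (-κ * l1 (quo L x - x')))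
    (hr : ∀ β z' k z, |r β z' k z| ≤ A * (((L : ℝ)) ^ (3 + 2))⁻¹ * Real.exp (-κ * l1 (quo L z - z')))
    (hr' : ∀ β z' k z i, |r β z' k (z + Pi.single i 1) - r β z' k z| ≤ A' * (((L : ℝ)) ^ (3 + 3))⁻¹ * Real.exp (-κ * l1 (quo L z - z')))
    (hr'' : ∀ β z' k z i j, |(r β z' k (z + Pi.single i 1 + Pi.single j 1) - r β z' k (z + Pi.single j 1)) - (r β z' k (z + Pi.single i 1) - r β z' k z)|
      ≤ A'' * (((L : ℝ)) ^ (3 + 3) * Real.sqrt (L : ℝ))⁻¹ * Real.exp (-κ * l1 (quo L z - z')))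
    (hw : ∀ ν U k u, |w ν U k u| ≤ A * (((L : ℝ)) ^ (3 + 2))⁻¹ * Real.exp (-κ * l1 (quo L u - U)))
    (hw' : ∀ ν U k u i, |w ν U k (u + Pi.single i 1) - w ν U k u| ≤ A' * (((L : ℝ)) ^ (3 + 3))⁻¹ * Real.exp (-κ * l1 (quo L u - U)))
    (hw'' : ∀ ν U k u i j, |(w ν U k (u + Pi.single i 1 + Pi.single j 1) - w ν U k (u + Pi.single j 1)) - (w ν U k (u + Pi.single i 1) - w ν U k u)|
      ≤ A'' * (((L : ℝ)) ^ (3 + 3) * Real.sqrt (L : ℝ))⁻¹ * Real.exp (-κ * l1 (quo L u - U)))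
    (hS : ∀ k u x z a b, |S k u x z a b| ≤ Cs * ω u * Real.exp (-m * (l1 (x - u) + l1 (z - u))))
    (y : Fin (3 + 1) → ℤ)
    (hω : ∀ u, 0 ≤ ω u ∧ ω u ≤ ∑ μ : Fin (3 + 1),
      (∑ v ∈ ((box (3 + 1) L).filter (fun v => v μ = L - 1)).image (fun v => (L : ℤ) • y + toSite v), Real.exp (-δ * l1 (v - u))
        + ∑ v ∈ ((box (3 + 1) L).filter (fun v => v μ = 0)).image (fun v => (L : ℤ) • y + toSite v - unitVec μ),
            Real.exp (-δ * l1 (v - u))))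
    (hQ : ∀ k κ₁ κ₂ u, ∑' x, ∑' z, S k u x z (Sum.inl κ₁) (Sum.inl κ₂) = ∑ y' ∈ T, Z k κ₁ κ₂ y' u)
    (hZ : ∀ k κ₁ κ₂, ∀ y' ∈ T, ∀ e, |Z k κ₁ κ₂ y' e| ≤ B * Real.exp (-δZ * l1 (e - y')))
    (hM0 : ∀ k κ₁ κ₂, ∀ y' ∈ T, ∑' e, Z k κ₁ κ₂ y' e = 0)
    (hP1 : ∀ k κ₁ κ₂, ∀ y' ∈ T, ∀ i : Fin (3 + 1), ∑' e, (((e - y') i : ℤ) : ℝ) * Z k κ₁ κ₂ y' e = 0)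
    (hT : ∀ y' ∈ T, l1 (quo L y' - Y) ≤ ρ) (hTcard : (T.card : ℝ) ≤ CT * (L : ℝ) ^ (3 + 1))
    (ν : Fin (3 + 1)) (U x' z' : Fin (3 + 1) → ℤ) (α β : Fin (3 + 1)) :
    |(L : ℝ) ^ (3 * (3 + 1)) * push₃ l r w S ν U x' z' (Sum.inl α) (Sum.inl β)|
      ≤ ((((3 : ℝ) + 1) ^ 3 * A ^ 2 * A' * Cs * (2 / (m - κ) * Zl (3 + 1) ((m - κ) / 2)) * (Zl (3 + 1) (m - κ) + Zl (3 + 1) m))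
            * ((2 * ((3 : ℝ) + 1)) ^ 2 * Zl (3 + 1) (δ / 2) * Real.exp (min (κ / 2) (δ / 2))))
          * ((L : ℝ))⁻¹
          * Real.exp (-(κ / 4) * (l1 (x' - U) + l1 (z' - U))) * Real.exp (-(min (κ / 2) (δ / 2)) * l1 (y - U))
        + ((3 : ℝ) + 1) ^ 3 *
          (((((A'' * A * A + 2 * A' * A' * A + A * A'' * A) * Real.exp (2 * κ) + 2 * ((A' * A + A * A') * Real.exp κ) * A' + A * A * A'')
              * Real.exp (2 * (2 * κ))) * B * (8 / (δZ - 2 * (2 * κ)) ^ 2 * Zl (3 + 1) ((δZ - 2 * (2 * κ)) / 4)) * Real.exp ((κ / 2) * ρ) * CT)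
            * (Real.sqrt (L : ℝ))⁻¹
            * Real.exp (-(κ / 4) * (l1 (x' - U) + l1 (z' - U))) * Real.exp (-(κ / 2) * l1 (Y - U))) := by
  have hL0 : (0 : ℝ) < (L : ℝ) := by exact_mod_cast hL
  have hL1 : (1 : ℝ) ≤ (L : ℝ) := by exact_mod_cast hL
  have hLne : (L : ℝ) ≠ 0 := hL0.ne'
  have hs0 : 0 < Real.sqrt (L : ℝ) := Real.sqrt_pos.2 hL0
  have hsne : Real.sqrt (L : ℝ) ≠ 0 := hs0.ne'
  have h := abs_cubic_push₃_layer_ledger_le (d := 3) (S₂ := (((L : ℝ)) ^ (3 + 3) * Real.sqrt (L : ℝ))⁻¹) hL hκ hm hδ hA hA' hA'' hCs hB hκδZ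
    (inv_pow_le_inv_pow_sqrt (L : ℝ) hL1 3) hl hl' hl'' hr hr' hr'' hw hw' hw'' hS y hω hQ hZ hM0 hP1 hT hTcard ν U x' z' α β
  have e1 : ((L : ℝ)) ^ 3 * (((L : ℝ)) ^ 4)⁻¹ = ((L : ℝ))⁻¹ := by field_simp
  have e2 : (((L : ℝ)) ^ (3 + 3) * Real.sqrt (L : ℝ))⁻¹ * ((L : ℝ)) ^ (2 * 3) = (Real.sqrt (L : ℝ))⁻¹ := by
    rw [mul_inv, mul_assoc, mul_comm ((Real.sqrt (L : ℝ))⁻¹), ← mul_assoc, show (2 * 3 : ℕ) = 3 + 3 from rfl,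
      inv_mul_cancel₀ (pow_ne_zero _ hLne), one_mul]
  have e3 : ((3 : ℕ) : ℝ) = (3 : ℝ) := by norm_num
  rw [e1, e2, e3] at h
  exact h

end End

end Summit.QuantumFields.BalabanUV.Beta.GAN24.LayerTransportLedger

end
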